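import Summits.AtomisticToContinuum.HydrodynamicLimit.Theses.OneFlightGossipEngine
import Summits.AtomisticToContinuum.HydrodynamicLimit.Theorems.AntiMazurCoboundariesKineticWindowGronwallGeneralFamilyGlue
import Summits.AtomisticToContinuum.HydrodynamicLimit.Theorems.AntiMazurCoboundariesKineticWindowGronwallTwoProfileTransfer
import HarnessLib

/-!
# One kinetic wall: the general-`F` node along families implies OneFlightGossipEngine's crux
# `KineticCurrentsLDAlongFamilies` (stmt-16659) — line `rare-band-ladder-dock` v7, crux `KineticWindowGronwall` (stmt-9282)

Crux `Summit.AtomisticToContinuum.HydrodynamicLimit.Theses.AntiMazurCoboundaries.KineticWindowGronwall`. The general-`F` family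
node `KineticWindowLDAlongFamiliesGeneral` (landed `…GeneralFamilyGlue.lean`, obtained there from the wall node in TwoClocks'
vocabulary `KineticWindowLDBoundsUniform` modulo the static change of measure `TwoProfileTransfer`) contains OneFlightGossipEngine's
docking crux `KineticCurrentsLDAlongFamilies` (stmt-16659; = the heart's `KineticCurrentsWindowLDFamily`, also TwoClocks 16625's child
S3b target): its structured member `F_s(x,v) = Σ A_s(x) w w + (b_s(x)·w) G_s(x, ‖w‖²)`, `w = v − u_s(x)`, is a jointly continuous
family of the general class (registered helper stub `stub_alongFamiliesDock`). With `PlusNode.localGibbsTransfer_of_plus` and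
`PlusNode.localTransferEB_of_plus` this records ONE kinetic wall behind three routes' cruxes: `LocalGibbsTransferPlus`
(= TwoClocks 14443 + bounds-uniform tilt radius + window clause) gives 14443, 9282's dockable wall `LocalTransferEB`, and — with
`TwoProfileTransfer` and TwoClocks 14440 — 16659.
-/

noncomputable section

namespace Summit.AtomisticToContinuum.HydrodynamicLimit.Theorems.KineticWindowGronwallFamilyGlue

open MeasureTheory Set Filter
open scoped ENNReal BigOperators
open Literature.Analysis.FluidPDE Literature.MathematicalPhysics.KineticTheory
open Summit.AtomisticToContinuum.HydrodynamicLimit.Theses.OneFlightGossipEngine (KineticCurrentsLDAlongFamilies)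

/-- Helper statement `AlongFamiliesDock` (registered helper stub `stub_alongFamiliesDock`, supports 9282): the general-`F` node
along families implies OneFlightGossipEngine's `KineticCurrentsLDAlongFamilies` (stmt-16659) verbatim. Route-internal. -/
def AlongFamiliesDock : Prop :=
  KineticWindowLDAlongFamiliesGeneral → KineticCurrentsLDAlongFamilies

/-- Joint continuity of the structured `(A, b, G)` member of 16659 along a family. [folklore] -/
theorem continuous_structuredMember {A : ℝ → T3 → Fin 3 → Fin 3 → ℝ} {b : ℝ → T3 → V3} {G : ℝ → T3 × ℝ → ℝ}
    {u₀ : ℝ → T3 → V3} (hA : Continuous (Function.uncurry A)) (hb : Continuous (Function.uncurry b))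
    (hG : Continuous (Function.uncurry G)) (hu : Continuous (Function.uncurry u₀)) :
    Continuous (Function.uncurry fun (s : ℝ) (y : T3 × V3) =>
      (∑ j : Fin 3, ∑ k : Fin 3, A s y.1 j k * ((y.2 - u₀ s y.1) j * (y.2 - u₀ s y.1) k)) +
        (∑ j : Fin 3, b s y.1 j * (y.2 - u₀ s y.1) j) * G s (y.1, ‖y.2 - u₀ s y.1‖ ^ 2)) := by
  have hsx : Continuous fun p : ℝ × (T3 × V3) => (p.1, p.2.1) := continuous_fst.prodMk (continuous_fst.comp continuous_snd)
  have hw : Continuous fun p : ℝ × (T3 × V3) => p.2.2 - u₀ p.1 p.2.1 :=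
    (continuous_snd.comp continuous_snd).sub (hu.comp hsx)
  have hwj : ∀ j : Fin 3, Continuous fun p : ℝ × (T3 × V3) => (p.2.2 - u₀ p.1 p.2.1) j := fun j =>
    (PiLp.continuous_apply 2 _ j).comp hw
  have hAjk : ∀ j k : Fin 3, Continuous fun p : ℝ × (T3 × V3) => A p.1 p.2.1 j k := fun j k =>
    (continuous_apply k).comp ((continuous_apply j).comp (hA.comp hsx))
  have hbj : ∀ j : Fin 3, Continuous fun p : ℝ × (T3 × V3) => b p.1 p.2.1 j := fun j =>
    (PiLp.continuous_apply 2 _ j).comp (hb.comp hsx)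
  have hGc : Continuous fun p : ℝ × (T3 × V3) => G p.1 (p.2.1, ‖p.2.2 - u₀ p.1 p.2.1‖ ^ 2) :=
    hG.comp (continuous_fst.prodMk ((continuous_fst.comp continuous_snd).prodMk (hw.norm.pow 2)))
  refine Continuous.add ?_ ?_
  · refine continuous_finsetSum _ fun j _ => continuous_finsetSum _ fun k _ => ?_
    exact (hAjk j k).mul ((hwj j).mul (hwj k))
  · exact (continuous_finsetSum _ fun j _ => (hbj j).mul (hwj j)).mul hGc

/-- **Registered helper stub `stub_alongFamiliesDock`**: the general-`F` node along families implies 16659 verbatim. [folklore] -/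
theorem stub_alongFamiliesDock : AlongFamiliesDock := by
  intro hG
  obtain ⟨η₀, hη₀, H⟩ := hG
  refine ⟨η₀, hη₀, ?_⟩
  intro t₁ a θ₀ u₀ hac hθc huc ha0 hθ0 σ hσ hguard Φ A b G hA hb hGc F hFC hO1 hO2 hO3
  exact H t₁ a θ₀ u₀ hac hθc huc ha0 hθ0 σ hσ hguard Φ F (continuous_structuredMember hA hb hGc huc) hFC hO1 hO2 hO3

/-- **ONE KINETIC WALL (record).** `TwoProfileTransfer → KineticWindowLDBoundsUniform → KineticCurrentsLDAlongFamilies (16659)`. -/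
theorem kineticCurrentsLDAlongFamilies_of_uniform (hT : TwoProfileTransfer)
    (hU : KineticWindowGronwallPlusNode.KineticWindowLDBoundsUniform) : KineticCurrentsLDAlongFamilies :=
  stub_alongFamiliesDock (stub_generalFamilyGlue hT hU)

/-- **ONE KINETIC WALL from the board crux 14440**: `TwoProfileTransfer → EquilibriumFastWindowLD → LocalGibbsTransferPlus →
KineticCurrentsLDAlongFamilies (16659)`. -/
theorem kineticCurrentsLDAlongFamilies_of_plus (hT : TwoProfileTransfer)
    (h₀ : Summit.AtomisticToContinuum.HydrodynamicLimit.Theses.TwoClocks.EquilibriumFastWindowLD)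
    (hP : KineticWindowGronwallPlusNode.LocalGibbsTransferPlus) : KineticCurrentsLDAlongFamilies :=
  kineticCurrentsLDAlongFamilies_of_uniform hT (hP h₀)

/-- **ONE KINETIC WALL from the board crux 14440, unconditionally in the statics** (the change of measure `TwoProfileTransfer` is LANDED,
`KineticWindowGronwallTwoProfileTransfer.stub_twoProfileTransfer`, same term): `EquilibriumFastWindowLD → LocalGibbsTransferPlus →
KineticCurrentsLDAlongFamilies (16659)`. -/
theorem kineticCurrentsLDAlongFamilies_of_plus'
    (h₀ : Summit.AtomisticToContinuum.HydrodynamicLimit.Theses.TwoClocks.EquilibriumFastWindowLD)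
    (hP : KineticWindowGronwallPlusNode.LocalGibbsTransferPlus) : KineticCurrentsLDAlongFamilies :=
  kineticCurrentsLDAlongFamilies_of_plus KineticWindowGronwallTwoProfileTransfer.stub_twoProfileTransfer h₀ hP

/-- **The wall node alone gives 16659** (statics landed): `KineticWindowLDBoundsUniform → KineticCurrentsLDAlongFamilies`. -/
theorem kineticCurrentsLDAlongFamilies_of_uniform' (hU : KineticWindowGronwallPlusNode.KineticWindowLDBoundsUniform) :
    KineticCurrentsLDAlongFamilies :=
  kineticCurrentsLDAlongFamilies_of_uniform KineticWindowGronwallTwoProfileTransfer.stub_twoProfileTransfer hU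

end Summit.AtomisticToContinuum.HydrodynamicLimit.Theorems.KineticWindowGronwallFamilyGlue

end
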